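import Literature.AlgebraicGeometry.Motives.PolyFormPullbackFunctorial
import Mathlib.RingTheory.Localization.Away.Basic
import Mathlib.Algebra.Module.LocalizedModule.Basic
import Mathlib.Tactic.Module
import HarnessLib

/-!
# Regular forms on a basic open are localized regular forms: `Ω^p(X_G) = Ω^p(X)_G`

[topic AlgebraicGeometry/Motives]

Let `k` be a commutative ring, `P = k[T₀, …, T_{N-1}]`, `I ⊆ P` an ideal, `X = V(I) ⊆ 𝔸ᴺ_k` and
`G ∈ P`. The basic open `X_G = X ∩ D(G)` is again affine, with the Rabinowitsch presentation
`X_G = V(I') ⊆ 𝔸ᴺ⁺¹`, `I' = I·k[T, t] + (tG − 1)` (`t = T_N` a new variable; coordinate ring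
`k[T, t]/I' = (P/I)_G`, Hartshorne II Prop. 2.2 (b)). In the tree's embedded model of Kähler forms
(`Motives/AffineAlgebraicDeRham`: `RegularForm I p = Ω^p_{P/k} ⧸ vanishingForms I p`, the regular
`p`-forms `Γ(X, Ω^p_{X/k})`) this file proves that **the restriction of regular forms**
`Ω^p(X) → Ω^p(X_G)` — the pull-back `RegularForm.comap` along `Tⱼ ↦ Tⱼ`
(`Motives/PolyFormPullback`) — **is a localization at the powers of `G`**
(`BasicOpen.isLocalizedModule_toForms`, Mathlib's `IsLocalizedModule (Submonoid.powers G)`):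

* `G` acts invertibly on `Ω^p(X_G)` (`BasicOpen.bijective_rename_smul`; inverse `t`);
* every regular form on `X_G` is `G^{-m}` times the restriction of a regular form on `X`
  (`BasicOpen.exists_pow_smul_eq_restrict`; on `tG = 1` one has `t = G⁻¹`, `dt = −G⁻² dG`);
* two regular forms on `X` with the same restriction agree after multiplication by a power of `G`
  (`BasicOpen.exists_pow_smul_eq_of_restrict_eq`).

This is the statement that Kähler differentials and their exterior powers commute with
localization — Görtz–Wedhorn II, Remark 17.19 (4), eq. (17.4.1) `T⁻¹Ω¹_{A/R} = Ω¹_{T⁻¹A/R}`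
(with (2): `Ω¹_{X/S}|_U = Ω¹_{U/S}` for an open subscheme, and (17.10): `Ω^p_{X/S} = ⋀^p Ω¹_{X/S}`
is quasi-coherent); Hartshorne II Prop. 8.2A (`Ω_{S⁻¹B/A} ≅ S⁻¹Ω_{B/A}`) — i.e. the equality
`Γ(X_G, Ω^p_X) = Γ(X, Ω^p_X)_G` of sections of the quasi-coherent sheaf `Ω^p_{X/k}` over a basic
open of the affine scheme `X` (Hartshorne II Prop. 5.1), here for the embedded carriers on which
the algebraic Čech–de Rham complex of an affine cover is written
(`HodgeTheory/AlgebraicCechDeRham`, whose row exactness for basic-open covers it feeds through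
`Algebra/Homology/CechLocalization`).

## Proof

The two "easy" thirds are computed on the hypersurface `tG = 1`: `tG` acts as `1`, and
`G·(dt ∧ θ) = d(tG − 1) ∧ θ − t·(dG ∧ θ)` (`BasicOpen.rename_smul_dWedge_X_last`), so by induction
on the degree through the generators `dTᵢ ∧ α` (`dWedge_X_induction`) every form `ω'` on `𝔸ᴺ⁺¹`
satisfies `G^m ω' ≡ ω(T)` modulo the forms vanishing on `tG = 1`
(`BasicOpen.exists_pow_smul_sub_comap_mem`). The kernel statement is proved in two steps.
(1) An UPPER BOUND for the recursively defined `vanishingForms I' p` by minimality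
(`vanishingForms_le`): the `k[T, t]`-submodule `BasicOpen.liftable` of the forms `ω'` with
`G^m ω' ≡ ω(T)` modulo forms vanishing on `tG = 1` for some `ω` VANISHING ON `X` contains `I'·Ω`
and is stable under `d` (`G^{m+1} dω' ≡ (G dω − m dG ∧ ω)(T)`). (2) A TORSION statement for the
hypersurface alone (`BasicOpen.exists_pow_smul_eq_zero_of_comap_mem`): if `θ(T)` vanishes on
`tG = 1` then `G^j θ = 0` for some `j`. For this we evaluate forms on the vector fields
`W_v = Σⱼ vⱼ ∂/∂Tⱼ − t²(∂_v G)(T) ∂/∂t` (`v ∈ ℤᴺ`), which have POLYNOMIAL coefficients, are tangent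
to `tG = 1` (`W_v(tG − 1) = −(tG − 1)·t·∂_vG`, `BasicOpen.locD_eqn`) and project to the constant
fields `v` on `𝔸ᴺ`: the evaluation `BasicOpen.locEval` is `k[T, t]`-linear, satisfies
`(df ∧ β)(W₀, …, W_p) = Σᵢ (−1)ⁱ Wᵢ(f) β(…Ŵᵢ…)` (`BasicOpen.locEval_dWedge`), hence sends every
form vanishing on `tG = 1` into `(tG − 1)` (`BasicOpen.vanishingForms_span_le_kerCond`), while
`θ(T)(W_{v₁}, …, W_{v_p}) = θ(v₁, …, v_p)(T)` (`BasicOpen.locEval_comap`); and a polynomial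
`θ₀ ∈ k[T]` divisible by `tG − 1` in `k[T, t]` dies in `k[T]_G = k[T, t]/(tG − 1)`, i.e. is killed
by a power of `G` (`BasicOpen.exists_pow_mul_eq_zero_of_rename_mem`, Mathlib
`IsLocalization.map_eq_zero_iff`).

Complements: `Ω^p(V(I))` is a module over the coordinate ring `k[T]/I`
(`RegularForm.instModuleQuotient`), and mutually inverse changes of presentation induce inverse
isomorphisms of regular forms (`RegularForm.comapEquiv`, from `Motives/PolyFormPullbackFunctorial`).

Everything is proved; no named facts (net debt 0); general commutative base ring `k`.

## References

* [GortzWedhorn2023] U. Görtz, T. Wedhorn, *Algebraic Geometry II: Cohomology of Schemes*,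
  Springer Spektrum (2023), doi:10.1007/978-3-658-43031-3: Remark 17.19 (2), (4) and eq. (17.4.1)
  (pp. 13–14), (17.10) and Prop. 17.56 (pp. 26–28).
* [Hartshorne1977] R. Hartshorne, *Algebraic Geometry*, GTM 52 (1977): II Prop. 2.2 (b), II
  Prop. 5.1, II Prop. 8.2A (p. 173).
* [Grothendieck1966] A. Grothendieck, *On the de Rham cohomology of algebraic varieties*, Publ.
  Math. IHÉS 29 (1966), p. 96 (6) (the use made of it: the Čech spectral sequence of `Ω•` on an
  affine cover).

## Design notes

* The restriction is packaged as a `k[T]`-LINEAR map `BasicOpen.toForms I G p` into the type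
  synonym `BasicOpen.Forms I G p` of `RegularForm (BasicOpen.ideal I G) p` carrying
  `Module.compHom` along `rename Fin.castSucc : k[T] → k[T, t]`, so that Mathlib's
  `IsLocalizedModule` applies verbatim; consumers with another presentation of `X_G` transport
  along `RegularForm.comapEquiv`, and pass to `k[T]/I`-modules with
  `IsLocalizedModule.of_restrictScalars`.
* No localized de Rham complex is constructed: the torsion statement (2) only needs the
  tangential derivations `W_v` with polynomial coefficients and the degree-`0` localization
  `k[T] → k[T]_G` (`Localization.Away`).
* Mathlib searched (pin v4.32): `KaehlerDifferential` (localization and base change of `Ω[S⁄R]` for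
  an abstract algebra), but the tree's de Rham carriers are the embedded `AffineDeRham.RegularForm`,
  not `Ω[S⁄R]`, and Mathlib has no exterior powers of `Ω[S⁄R]`; used: `IsLocalizedModule`,
  `IsLocalization.map_eq_zero_iff`, `IsLocalization.Away.invSelf`, `MvPolynomial.pderiv_rename`,
  `MvPolynomial.vars_rename`, `Module.IsTorsionBySet.module`.
-/

noncomputable section

open MvPolynomial

namespace Literature.AlgebraicGeometry.Motives

namespace AffineDeRham

namespace BasicOpen

variable {k : Type*} [CommRing k] {N : ℕ}

/-- Notation (local): `P = k[T₀, …, T_{N-1}]`, the polynomial ring of `𝔸ᴺ`. -/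
local notation "P" => MvPolynomial (Fin N) k
/-- Notation (local): `P' = k[T₀, …, T_{N-1}, t]`, the polynomial ring of `𝔸ᴺ⁺¹ = 𝔸ᴺ × 𝔸¹`. -/
local notation "P'" => MvPolynomial (Fin (N + 1)) k

/-! ### The Rabinowitsch presentation `X_G = V(I, tG − 1) ⊆ 𝔸ᴺ⁺¹` of a basic open -/

variable (N) in
/-- The polynomial lift `Tⱼ ↦ Tⱼ` (`j < N`) of the projection `𝔸ᴺ × 𝔸¹ → 𝔸ᴺ` restricted to the
basic open: the substitution along which forms on `X` are restricted to `X_G`. [folklore] -/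
def incl : Fin N → MvPolynomial (Fin (N + 1)) k := fun j => X (Fin.castSucc j)

/-- `incl N j = T_j`. [cite: Hartshorne1975, Ch. II §1] -/
@[simp]
theorem incl_apply (j : Fin N) : (incl N j : P') = X (Fin.castSucc j) := rfl

/-- Substitution along `incl` is the renaming `Tⱼ ↦ Tⱼ`. [cite: Hartshorne1975, Ch. II §1] -/
theorem bind₁_incl : (bind₁ (incl N) : P →ₐ[k] P') = rename Fin.castSucc :=
  algHom_ext fun j => by rw [bind₁_X_right, incl_apply, rename_X]

/-- Substitution along `incl`, applied. [cite: Hartshorne1975, Ch. II §1] -/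
@[simp]
theorem bind₁_incl_apply (f : P) : bind₁ (incl N) f = rename Fin.castSucc f := by
  rw [bind₁_incl]

/-- The equation `t · G(T) − 1` of the basic open `X_G` inside `X × 𝔸¹` (`t = T_N` the last
variable). [folklore] -/
def eqn (G : P) : P' := X (Fin.last N) * rename Fin.castSucc G - 1

/-- `t · G = (tG − 1) + 1`. [cite: Hartshorne1977, II Prop. 2.2 (b)] -/
theorem X_last_mul_rename (G : P) : X (Fin.last N) * rename Fin.castSucc G = eqn G + 1 := by
  rw [eqn, sub_add_cancel]

/-- **The ideal of the basic open** `X_G` of `X = V(I)`, presented in `𝔸ᴺ⁺¹`: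
`I' = I·k[T, t] + (tG − 1)`, so that `k[T, t]/I' = (k[T]/I)_G = Γ(X_G, 𝒪)`.
[cite: Hartshorne1977, II Prop. 2.2 (b)] -/
def ideal (I : Ideal P) (G : P) : Ideal P' :=
  I.map (bind₁ (incl N) : P →ₐ[k] P') ⊔ Ideal.span {eqn G}

variable {I : Ideal (MvPolynomial (Fin N) k)} {G : MvPolynomial (Fin N) k} {p : ℕ}

variable (I G) in
/-- `I · k[T, t] ⊆ I'`. [cite: Hartshorne1977, II Prop. 2.2 (b)] -/
theorem map_incl_le_ideal : I.map (bind₁ (incl N) : P →ₐ[k] P') ≤ ideal I G :=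
  le_sup_left

variable (I G) in
/-- `tG − 1 ∈ I'`. [cite: Hartshorne1977, II Prop. 2.2 (b)] -/
theorem eqn_mem_ideal : eqn G ∈ ideal I G :=
  Ideal.mem_sup_right (Ideal.subset_span rfl)

variable (I G) in
/-- `span {tG − 1} ⊆ I'`. [cite: Hartshorne1977, II Prop. 2.2 (b)] -/
theorem span_eqn_le_ideal : Ideal.span {eqn G} ≤ ideal I G :=
  le_sup_right

variable (G) in
/-- For `f ∈ I`, `f(T) ∈ I'`. [cite: Hartshorne1977, II Prop. 2.2 (b)] -/
theorem rename_mem_ideal {f : P} (hf : f ∈ I) : rename Fin.castSucc f ∈ ideal I G := by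
  rw [← bind₁_incl_apply]
  exact map_incl_le_ideal I G (Ideal.mem_map_of_mem _ hf)

variable (I G p) in
/-- **Restriction of regular forms to the basic open**, `Ω^p(X) → Ω^p(X_G)`: the pull-back along
`incl` (`RegularForm.comap`). [cite: GortzWedhorn2023, Remark 17.19 (2)] -/
abbrev restrict : RegularForm I p →ₗ[k] RegularForm (ideal I G) p :=
  RegularForm.comap (incl N) (map_incl_le_ideal I G) p

/-- Restriction on the class of a polynomial form. [cite: GortzWedhorn2023, Remark 17.19 (2)] -/
theorem restrict_mk (ω : PolyForm k N p) :
    restrict I G p (RegularForm.mk I ω) = RegularForm.mk (ideal I G) (PolyForm.comap (incl N) ω) :=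
  rfl

/-! ### `G` is a unit on `Ω^p(X_G)`: `t · (G · r) = r` -/

/-- **`tG` acts as the identity on `Ω^p(X_G)`** (`tG − 1 ∈ I'`). [cite: GortzWedhorn2023, Remark 17.19 (4)] -/
theorem X_last_mul_rename_smul (r : RegularForm (ideal I G) p) :
    (X (Fin.last N) * rename Fin.castSucc G) • r = r := by
  obtain ⟨ω, rfl⟩ := RegularForm.mk_surjective _ r
  rw [← map_smul, ← sub_eq_zero, ← map_sub, RegularForm.mk_eq_zero_iff, X_last_mul_rename,
    add_smul, one_smul, add_sub_cancel_right]
  exact smul_mem_vanishingForms _ (eqn_mem_ideal I G) ω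

/-- Multiplication by `G(T)` on `Ω^p(X_G)` is bijective (inverse: multiplication by `t`).
[cite: GortzWedhorn2023, Remark 17.19 (4)] -/
theorem bijective_rename_smul :
    Function.Bijective fun r : RegularForm (ideal I G) p => rename Fin.castSucc G • r := by
  refine Function.bijective_iff_has_inverse.mpr
    ⟨fun r => (X (Fin.last N) : P') • r, fun r => ?_, fun r => ?_⟩
  · change (X (Fin.last N) : P') • rename Fin.castSucc G • r = r
    rw [smul_smul, X_last_mul_rename_smul]
  · change rename Fin.castSucc G • (X (Fin.last N) : P') • r = r
    rw [smul_smul, mul_comm, X_last_mul_rename_smul]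

/-! ### Every form on `X_G` is `G^{-m}` times a form coming from `X` -/

/-- Notation (local): the forms on `𝔸ᴺ⁺¹` vanishing on the hypersurface `tG = 1`. -/
local notation "D" => vanishingForms (Ideal.span {eqn G})

variable (G) in
/-- Degree `0`, polynomial level: every `f' ∈ k[T, t]` satisfies
`G^m f' = f(T) + (tG − 1) h` for some `m`, `f ∈ k[T]`, `h` (clear the denominators `t = 1/G`).
[cite: Hartshorne1977, II Prop. 2.2 (b)] -/
theorem exists_pow_mul_eq_rename_add (f' : P') :
    ∃ (m : ℕ) (f : P) (h : P'), rename Fin.castSucc G ^ m * f' = rename Fin.castSucc f + eqn G * h := by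
  induction f' using MvPolynomial.induction_on with
  | C a => exact ⟨0, C a, 0, by rw [pow_zero, one_mul, rename_C, mul_zero, add_zero]⟩
  | add f₁ f₂ h₁ h₂ =>
    obtain ⟨m₁, g₁, h₁, e₁⟩ := h₁
    obtain ⟨m₂, g₂, h₂, e₂⟩ := h₂
    refine ⟨m₁ + m₂, G ^ m₂ * g₁ + G ^ m₁ * g₂,
      rename Fin.castSucc G ^ m₂ * h₁ + rename Fin.castSucc G ^ m₁ * h₂, ?_⟩
    rw [mul_add, show rename Fin.castSucc G ^ (m₁ + m₂) * f₁ =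
        rename Fin.castSucc G ^ m₂ * (rename Fin.castSucc G ^ m₁ * f₁) by ring, e₁,
      show rename Fin.castSucc G ^ (m₁ + m₂) * f₂ =
        rename Fin.castSucc G ^ m₁ * (rename Fin.castSucc G ^ m₂ * f₂) by ring, e₂,
      map_add, map_mul, map_mul, map_pow, map_pow]
    ring
  | mul_X f' i hf =>
    obtain ⟨m, f, h, e⟩ := hf
    cases i using Fin.lastCases with
    | last =>
      refine ⟨m + 1, f, rename Fin.castSucc f + h * (X (Fin.last N) * rename Fin.castSucc G), ?_⟩
      rw [show rename Fin.castSucc G ^ (m + 1) * (f' * X (Fin.last N)) =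
          (X (Fin.last N) * rename Fin.castSucc G) * (rename Fin.castSucc G ^ m * f') by ring, e,
        X_last_mul_rename]
      ring
    | cast j =>
      refine ⟨m, f * X j, h * X (Fin.castSucc j), ?_⟩
      rw [← mul_assoc, e, map_mul, rename_X]
      ring

/-- If `G^m ω' − ω(T)` vanishes on `tG = 1` then so does `G^{m+j} ω' − (G^j ω)(T)`. [folklore] -/
private theorem pow_add_smul_sub_comap_mem {m : ℕ} {ω' : PolyForm k (N + 1) p} {ω : PolyForm k N p}
    (h : rename Fin.castSucc G ^ m • ω' - PolyForm.comap (incl N) ω ∈ D p) (j : ℕ) :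
    rename Fin.castSucc G ^ (m + j) • ω' - PolyForm.comap (incl N) (G ^ j • ω) ∈ D p := by
  rw [PolyForm.comap_polySmul, bind₁_incl_apply, map_pow, pow_add, mul_comm, mul_smul, ← smul_sub]
  exact Submodule.smul_mem _ _ h

/-- `d1 ∧ θ = 0`. [cite: GortzWedhorn2023, Prop. 17.54] -/
theorem dWedge_one {n : ℕ} (θ : PolyForm k n p) : dWedge (1 : MvPolynomial (Fin n) k) θ = 0 := by
  have h := dWedge_mul (1 : MvPolynomial (Fin n) k) 1 θ
  rw [one_mul, one_smul] at h
  exact left_eq_add.mp h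

/-- `d(f − g) ∧ η = df ∧ η − dg ∧ η`. [cite: GortzWedhorn2023, Prop. 17.54] -/
theorem dWedge_sub_left {n : ℕ} (f g : MvPolynomial (Fin n) k) (η : PolyForm k n p) :
    dWedge (f - g) η = dWedge f η - dWedge g η := by
  refine AlternatingMap.ext fun v => ?_
  simp only [dWedge_apply, map_sub, AlternatingMap.sub_apply, ← Finset.sum_sub_distrib]
  exact Finset.sum_congr rfl fun i _ => by ring

/-- `df ∧ (a − b) = df ∧ a − df ∧ b`. [cite: GortzWedhorn2023, Prop. 17.54] -/
theorem dWedge_sub_right {n : ℕ} (f : MvPolynomial (Fin n) k) (a b : PolyForm k n p) :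
    dWedge f (a - b) = dWedge f a - dWedge f b := by
  refine AlternatingMap.ext fun v => ?_
  simp only [dWedge_apply, AlternatingMap.sub_apply, mul_sub, Finset.sum_sub_distrib]

/-- `dg ∧ θ` vanishes on `V(J)` whenever `θ` does (`dg ∧ θ = d(gθ) − g dθ`). [cite: Hartshorne1977, II Prop. 8.4A] -/
theorem dWedge_mem_vanishingForms_of_mem {n : ℕ} (J : Ideal (MvPolynomial (Fin n) k))
    (g : MvPolynomial (Fin n) k) {θ : PolyForm k n p} (hθ : θ ∈ vanishingForms J p) :
    dWedge g θ ∈ vanishingForms J (p + 1) := by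
  have h : dWedge g θ = extDeriv (g • θ) - g • extDeriv θ := by
    rw [extDeriv_smul, add_sub_cancel_right]
  rw [h]
  exact Submodule.sub_mem _ (extDeriv_mem_vanishingForms _ (Submodule.smul_mem _ _ hθ))
    (Submodule.smul_mem _ _ (extDeriv_mem_vanishingForms _ hθ))

/-- `d(tG − 1) ∧ θ` vanishes on `tG = 1`. [folklore] -/
private theorem dWedge_eqn_mem (θ : PolyForm k (N + 1) p) : dWedge (eqn G) θ ∈ D (p + 1) :=
  dWedge_mem_vanishingForms (Ideal.span {eqn G}) (Ideal.mem_span_singleton_self _) θ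

/-- `(tG − 1) θ` vanishes on `tG = 1`. [folklore] -/
private theorem eqn_smul_mem (θ : PolyForm k (N + 1) p) : eqn G • θ ∈ D p :=
  smul_mem_vanishingForms (Ideal.span {eqn G}) (Ideal.mem_span_singleton_self _) θ

/-- The key relation on `tG = 1`: `G · (dt ∧ θ) = d(tG − 1) ∧ θ − t · (dG ∧ θ)`. [cite: GortzWedhorn2023, Remark 17.19 (4)] -/
theorem rename_smul_dWedge_X_last (θ : PolyForm k (N + 1) p) :
    rename Fin.castSucc G • dWedge (X (Fin.last N)) θ =
      dWedge (eqn G) θ - (X (Fin.last N) : P') • dWedge (rename Fin.castSucc G) θ := by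
  rw [eqn, dWedge_sub_left, dWedge_one, sub_zero, dWedge_mul]
  abel

variable (G) in
/-- **Clearing denominators**, polynomial level: for every polynomial `p`-form `ω'` on `𝔸ᴺ⁺¹`
there are `m` and a `p`-form `ω` on `𝔸ᴺ` with `G^m ω' − ω(T)` vanishing on the hypersurface
`tG = 1` (on which `t = 1/G` and `dt = −dG/G²`). [cite: GortzWedhorn2023, Remark 17.19 (4)] -/
theorem exists_pow_smul_sub_comap_mem :
    ∀ {p : ℕ} (ω' : PolyForm k (N + 1) p), ∃ (m : ℕ) (ω : PolyForm k N p),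
      rename Fin.castSucc G ^ m • ω' - PolyForm.comap (incl N) ω ∈ D p
  | 0, ω' => by
    obtain ⟨f', rfl⟩ := (ofPoly (k := k) (n := N + 1)).surjective ω'
    obtain ⟨m, f, h, e⟩ := exists_pow_mul_eq_rename_add G f'
    refine ⟨m, ofPoly f, ?_⟩
    have e' : rename Fin.castSucc G ^ m • ofPoly f' - PolyForm.comap (incl N) (ofPoly f) =
        eqn G • (ofPoly h : PolyForm k (N + 1) 0) := by
      rw [PolyForm.comap_ofPoly, bind₁_incl_apply, ← map_smul, ← map_smul, smul_eq_mul, smul_eq_mul,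
        e, map_add, add_sub_cancel_left]
    rw [e']
    exact eqn_smul_mem (ofPoly h)
  | p + 1, ω' => by
    refine dWedge_X_induction
      (C := fun ω' => ∃ (m : ℕ) (ω : PolyForm k N (p + 1)),
        rename Fin.castSucc G ^ m • ω' - PolyForm.comap (incl N) ω ∈ D (p + 1))
      ⟨0, 0, by rw [smul_zero, map_zero, sub_zero]; exact Submodule.zero_mem _⟩
      (fun a b ⟨m₁, ω₁, h₁⟩ ⟨m₂, ω₂, h₂⟩ => ?_) (fun i α => ?_) ω'
    · refine ⟨m₁ + m₂, G ^ m₂ • ω₁ + G ^ m₁ • ω₂, ?_⟩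
      have e : rename Fin.castSucc G ^ (m₁ + m₂) • (a + b) -
          PolyForm.comap (incl N) (G ^ m₂ • ω₁ + G ^ m₁ • ω₂) =
        (rename Fin.castSucc G ^ (m₁ + m₂) • a - PolyForm.comap (incl N) (G ^ m₂ • ω₁)) +
          (rename Fin.castSucc G ^ (m₂ + m₁) • b - PolyForm.comap (incl N) (G ^ m₁ • ω₂)) := by
        rw [map_add, add_comm m₂ m₁, smul_add]
        abel
      rw [e]
      exact Submodule.add_mem _ (pow_add_smul_sub_comap_mem h₁ m₂) (pow_add_smul_sub_comap_mem h₂ m₁)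
    · obtain ⟨m, β, hβ⟩ := exists_pow_smul_sub_comap_mem α
      cases i using Fin.lastCases with
      | cast j =>
        refine ⟨m, dWedge (X j) β, ?_⟩
        rw [← dWedge_smul_right, PolyForm.comap_dWedge, bind₁_X_right, incl_apply, ← dWedge_sub_right]
        exact dWedge_mem_vanishingForms_of_mem _ _ hβ
      | last =>
        refine ⟨m + 2, -dWedge G β, ?_⟩
        set eG := rename Fin.castSucc G with heG
        set t : P' := X (Fin.last N) with ht
        set δ := eG ^ m • α - PolyForm.comap (incl N) β with hδ
        have hc : PolyForm.comap (incl N) (-dWedge G β) = -dWedge eG (eG ^ m • α - δ) := by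
          rw [map_neg, PolyForm.comap_dWedge, bind₁_incl_apply, hδ, sub_sub_cancel]
        have h1 : eG • dWedge t α = dWedge (eqn G) α - t • dWedge eG α :=
          rename_smul_dWedge_X_last α
        have h2 : t * eG = eqn G + 1 := X_last_mul_rename G
        have key : eG ^ (m + 2) • dWedge t α - PolyForm.comap (incl N) (-dWedge G β) =
            eG ^ (m + 1) • dWedge (eqn G) α - eqn G • dWedge eG (eG ^ m • α) - dWedge eG δ := by
          rw [hc, dWedge_sub_right, dWedge_smul_right,
            show eG ^ (m + 2) • dWedge t α = eG ^ (m + 1) • (eG • dWedge t α) by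
              rw [smul_smul, ← pow_succ],
            h1, smul_sub,
            show eG ^ (m + 1) • t • dWedge eG α = (t * eG) • (eG ^ m • dWedge eG α) by
              rw [smul_smul, smul_smul, pow_succ]; ring_nf,
            h2]
          module
        rw [key]
        exact Submodule.sub_mem _ (Submodule.sub_mem _ (Submodule.smul_mem _ _ (dWedge_eqn_mem α))
          (eqn_smul_mem _)) (dWedge_mem_vanishingForms_of_mem _ _ hβ)

/-! ### An upper bound for the forms vanishing on `X_G` -/

/-- `g · (d(g^m) ∧ θ) = m · dg ∧ (g^m θ)`. [cite: GortzWedhorn2023, Prop. 17.54] -/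
theorem smul_dWedge_pow {n : ℕ} (g : MvPolynomial (Fin n) k) (θ : PolyForm k n p) (m : ℕ) :
    g • dWedge (g ^ m) θ = (m : MvPolynomial (Fin n) k) • dWedge g (g ^ m • θ) := by
  induction m with
  | zero => rw [pow_zero, dWedge_one, smul_zero, Nat.cast_zero, zero_smul]
  | succ m ih =>
    rw [pow_succ', dWedge_mul, smul_add, ih, dWedge_smul_right, dWedge_smul_right, Nat.cast_succ]
    module

variable (I G p) in
/-- The polynomial `p`-forms `ω'` on `𝔸ᴺ⁺¹` some multiple `G^m ω'` of which is, modulo forms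
vanishing on the hypersurface `tG = 1`, the pull-back `ω(T)` of a form `ω` vanishing on `X = V(I)`.
A `k[T, t]`-submodule containing `I'·Ω` and stable under `d`, hence an upper bound for the forms
vanishing on `X_G = V(I')` — the inclusion `vanishingForms (ideal I G) p ≤ liftable I G p` is
the injectivity half of `Ω^p(X_G) = Ω^p(X)_G`. [folklore] -/
def liftable : Submodule (MvPolynomial (Fin (N + 1)) k) (PolyForm k (N + 1) p) where
  carrier := {ω' | ∃ m : ℕ, ∃ ω ∈ vanishingForms I p,
    rename Fin.castSucc G ^ m • ω' - PolyForm.comap (incl N) ω ∈ D p}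
  zero_mem' := ⟨0, 0, Submodule.zero_mem _, by
    rw [smul_zero, map_zero, sub_zero]; exact Submodule.zero_mem _⟩
  add_mem' := by
    rintro a b ⟨m₁, ω₁, hω₁, h₁⟩ ⟨m₂, ω₂, hω₂, h₂⟩
    refine ⟨m₁ + m₂, G ^ m₂ • ω₁ + G ^ m₁ • ω₂,
      Submodule.add_mem _ (Submodule.smul_mem _ _ hω₁) (Submodule.smul_mem _ _ hω₂), ?_⟩
    have e : rename Fin.castSucc G ^ (m₁ + m₂) • (a + b) -
        PolyForm.comap (incl N) (G ^ m₂ • ω₁ + G ^ m₁ • ω₂) =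
      (rename Fin.castSucc G ^ (m₁ + m₂) • a - PolyForm.comap (incl N) (G ^ m₂ • ω₁)) +
        (rename Fin.castSucc G ^ (m₂ + m₁) • b - PolyForm.comap (incl N) (G ^ m₁ • ω₂)) := by
      rw [map_add, add_comm m₂ m₁, smul_add]
      abel
    rw [e]
    exact Submodule.add_mem _ (pow_add_smul_sub_comap_mem h₁ m₂) (pow_add_smul_sub_comap_mem h₂ m₁)
  smul_mem' := by
    rintro f' ω' ⟨m, ω, hω, h⟩
    obtain ⟨j, f, h', e⟩ := exists_pow_mul_eq_rename_add G f'
    refine ⟨m + j, f • ω, Submodule.smul_mem _ _ hω, ?_⟩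
    have key : rename Fin.castSucc G ^ (m + j) • f' • ω' - PolyForm.comap (incl N) (f • ω) =
        rename Fin.castSucc f • (rename Fin.castSucc G ^ m • ω' - PolyForm.comap (incl N) ω) +
          eqn G • (h' • rename Fin.castSucc G ^ m • ω') := by
      rw [PolyForm.comap_polySmul, bind₁_incl_apply, smul_smul (rename Fin.castSucc G ^ (m + j)) f' ω',
        show rename Fin.castSucc G ^ (m + j) * f' =
          rename Fin.castSucc G ^ m * (rename Fin.castSucc f + eqn G * h') by rw [pow_add, mul_assoc, e]]
      module
    rw [key]
    exact Submodule.add_mem _ (Submodule.smul_mem _ _ h) (eqn_smul_mem _)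

/-- Membership in `liftable`. [cite: GortzWedhorn2023, Remark 17.19 (4)] -/
theorem mem_liftable_iff {ω' : PolyForm k (N + 1) p} :
    ω' ∈ liftable I G p ↔ ∃ m : ℕ, ∃ ω ∈ vanishingForms I p,
      rename Fin.castSucc G ^ m • ω' - PolyForm.comap (incl N) ω ∈ D p :=
  Iff.rfl

/-- Forms vanishing on the hypersurface `tG = 1` are liftable (with `m = 0`, `ω = 0`). [cite: GortzWedhorn2023, Remark 17.19 (4)] -/
theorem vanishingForms_span_eqn_le_liftable : D p ≤ liftable I G p := fun δ hδ =>
  ⟨0, 0, Submodule.zero_mem _, by rwa [pow_zero, one_smul, map_zero, sub_zero]⟩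

/-- `I'·Ω^p ⊆ liftable`: for `f ∈ I`, `f(T) ω'` is liftable by clearing denominators in `ω'`.
[cite: GortzWedhorn2023, Remark 17.19 (4)] -/
theorem smul_top_le_liftable : ideal I G • ⊤ ≤ liftable I G p := by
  rw [ideal, Submodule.sup_smul]
  refine sup_le (Submodule.smul_le.mpr fun c hc ω' _ => ?_)
    ((smul_top_le_vanishingForms _ p).trans vanishingForms_span_eqn_le_liftable)
  refine Submodule.span_induction
    (p := fun c _ => ∀ ω' : PolyForm k (N + 1) p, c • ω' ∈ liftable I G p) ?_ ?_ ?_ ?_ hc ω'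
  · rintro _ ⟨f, hf, rfl⟩ ω'
    obtain ⟨m, ω, h⟩ := exists_pow_smul_sub_comap_mem G ω'
    refine ⟨m, f • ω, smul_mem_vanishingForms I hf ω, ?_⟩
    have e : rename Fin.castSucc G ^ m • (bind₁ (incl N) : P →ₐ[k] P') f • ω' -
        PolyForm.comap (incl N) (f • ω) =
      rename Fin.castSucc f • (rename Fin.castSucc G ^ m • ω' - PolyForm.comap (incl N) ω) := by
      rw [PolyForm.comap_polySmul, bind₁_incl_apply, smul_sub, smul_comm]
    rw [e]
    exact Submodule.smul_mem _ _ h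
  · intro ω'
    rw [zero_smul]
    exact Submodule.zero_mem _
  · intro c₁ c₂ _ _ h₁ h₂ ω'
    rw [add_smul]
    exact Submodule.add_mem _ (h₁ ω') (h₂ ω')
  · intro a c _ hc ω'
    rw [smul_eq_mul, mul_smul]
    exact Submodule.smul_mem _ _ (hc ω')

/-- **`liftable` is stable under `d`**: if `G^m ω' = ω(T) + δ` then
`G^{m+1} dω' = (G dω − m dG ∧ ω)(T) + (G dδ − m dG ∧ δ)`. [cite: GortzWedhorn2023, Remark 17.19 (4)] -/
theorem extDeriv_mem_liftable {ω' : PolyForm k (N + 1) p} (h : ω' ∈ liftable I G p) :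
    extDeriv ω' ∈ liftable I G (p + 1) := by
  obtain ⟨m, ω, hω, hδ⟩ := h
  set eG := rename Fin.castSucc G with heG
  set δ := eG ^ m • ω' - PolyForm.comap (incl N) ω with hδdef
  refine ⟨m + 1, G • extDeriv ω - (m : P) • dWedge G ω,
    Submodule.sub_mem _ (Submodule.smul_mem _ _ (extDeriv_mem_vanishingForms I hω))
      (Submodule.smul_mem _ _ (dWedge_mem_vanishingForms_of_mem I G hω)), ?_⟩
  have hsplit : eG ^ m • ω' = PolyForm.comap (incl N) ω + δ := by rw [hδdef, add_sub_cancel]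
  have h1 : eG ^ m • extDeriv ω' =
      PolyForm.comap (incl N) (extDeriv ω) + extDeriv δ - dWedge (eG ^ m) ω' := by
    have hd := extDeriv_smul (eG ^ m) ω'
    rw [hsplit, extDeriv_add, ← PolyForm.comap_extDeriv] at hd
    rw [hd, add_sub_cancel_left]
  have h2 : eG • dWedge (eG ^ m) ω' =
      (m : P') • (PolyForm.comap (incl N) (dWedge G ω) + dWedge eG δ) := by
    rw [smul_dWedge_pow, hsplit, dWedge_add, PolyForm.comap_dWedge, bind₁_incl_apply]
  have key : eG ^ (m + 1) • extDeriv ω' -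
      PolyForm.comap (incl N) (G • extDeriv ω - (m : P) • dWedge G ω) =
        eG • extDeriv δ - (m : P') • dWedge eG δ := by
    rw [pow_succ', mul_smul, h1, smul_sub, smul_add, h2, map_sub, PolyForm.comap_polySmul,
      PolyForm.comap_polySmul, bind₁_incl_apply, bind₁_incl_apply, map_natCast, ← heG,
      PolyForm.comap_dWedge, bind₁_incl_apply, ← heG]
    module
  rw [key]
  exact Submodule.sub_mem _ (Submodule.smul_mem _ _ (extDeriv_mem_vanishingForms _ hδ))
    (Submodule.smul_mem _ _ (dWedge_mem_vanishingForms_of_mem _ _ hδ))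

/-- **The forms vanishing on `X_G` are liftable** (minimality of `vanishingForms`).
[cite: GortzWedhorn2023, Remark 17.19 (4)] -/
theorem vanishingForms_ideal_le_liftable : vanishingForms (ideal I G) p ≤ liftable I G p :=
  vanishingForms_le (ideal I G) (N := liftable I G) (fun _ => smul_top_le_liftable)
    (fun _ _ hω => extDeriv_mem_liftable hω) p

/-! ### Evaluating forms on the vector fields tangent to the hypersurface `tG = 1` -/

/-- The functions `(T₀, …, T_{N-1}, G)` whose gradients give the fields. [folklore] -/
def wfun (G : P) : Fin (N + 1) → P := Fin.snoc (fun j => X j) G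

/-- The coefficients `(1, …, 1, −t²)` of the fields. [folklore] -/
def wcoef : Fin (N + 1) → MvPolynomial (Fin (N + 1)) k :=
  Fin.snoc (fun _ => 1) (-(X (Fin.last N) ^ 2))

variable (G) in
/-- **The components of the vector fields `W_v = Σⱼ vⱼ ∂/∂Tⱼ − t² (∂_v G)(T) ∂/∂t`** on `𝔸ᴺ⁺¹`
(`v ∈ ℤᴺ`), as additive maps in `v`: `(W_v)ᵢ = vᵢ` for `i < N` and `(W_v)_N = −t² (∂_v G)(T)`.
These fields are tangent to the hypersurface `tG = 1` (on which they are the coordinate fields of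
`X_G ≅ D(G) ⊆ 𝔸ᴺ`, written with `t = 1/G`: `d(1/G) = −G⁻² dG`), with POLYNOMIAL coefficients.
[folklore] -/
def weight (i : Fin (N + 1)) : (Fin N → ℤ) →ₗ[ℤ] MvPolynomial (Fin (N + 1)) k where
  toFun v := wcoef i * rename Fin.castSucc (grad (wfun G i) v)
  map_add' v w := by rw [map_add, map_add, mul_add]
  map_smul' c v := by rw [map_smul, map_zsmul, RingHom.id_apply, mul_smul_comm]

/-- `(W_v)ⱼ = vⱼ` for `j < N`. [cite: GortzWedhorn2023, Remark 17.19 (4)] -/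
@[simp]
theorem weight_castSucc (j : Fin N) (v : Fin N → ℤ) : weight G (Fin.castSucc j) v = C (v j : k) := by
  simp [weight, wfun, wcoef]

/-- `(W_v)_N = −t² (∂_v G)(T)`. [cite: GortzWedhorn2023, Remark 17.19 (4)] -/
@[simp]
theorem weight_last (v : Fin N → ℤ) :
    weight G (Fin.last N) v = -(X (Fin.last N) ^ 2 * rename Fin.castSucc (dirDeriv v G)) := by
  simp [weight, wfun, wcoef]

variable (G) in
/-- **Evaluation of a polynomial `p`-form on `𝔸ᴺ⁺¹` on the fields `W_{v₁}, …, W_{v_p}`**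
(multilinearly extended from the constant fields: `ω'(W_{v₁}, …, W_{v_p}) =
Σ_J (∏ₐ (W_{vₐ})_{J a}) ω'(e_{J 1}, …, e_{J p})`), a `P'`-valued multilinear map in
`(v₁, …, v_p) ∈ (ℤᴺ)^p`. [folklore] -/
def locEval (ω' : PolyForm k (N + 1) p) :
    MultilinearMap ℤ (fun _ : Fin p => Fin N → ℤ) (MvPolynomial (Fin (N + 1)) k) :=
  ∑ J : Fin p → Fin (N + 1), ω' (fun a => Pi.single (J a) 1) •
    (MultilinearMap.mkPiAlgebra ℤ (Fin p) (MvPolynomial (Fin (N + 1)) k)).compLinearMap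
      fun a => weight G (J a)

/-- Unfolding `locEval`. [cite: GortzWedhorn2023, Remark 17.19 (4)] -/
theorem locEval_apply (ω' : PolyForm k (N + 1) p) (v : Fin p → Fin N → ℤ) :
    locEval G ω' v =
      ∑ J : Fin p → Fin (N + 1), ω' (fun a => Pi.single (J a) 1) * ∏ a, weight G (J a) (v a) := by
  simp [locEval]

/-- `locEval` is additive in the form. [cite: GortzWedhorn2023, Remark 17.19 (4)] -/
theorem locEval_add (a b : PolyForm k (N + 1) p) (v : Fin p → Fin N → ℤ) :
    locEval G (a + b) v = locEval G a v + locEval G b v := by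
  simp only [locEval_apply, AlternatingMap.add_apply, add_mul, Finset.sum_add_distrib]

/-- `locEval` is `P'`-linear in the form. [cite: GortzWedhorn2023, Remark 17.19 (4)] -/
theorem locEval_smul (f : MvPolynomial (Fin (N + 1)) k) (ω' : PolyForm k (N + 1) p)
    (v : Fin p → Fin N → ℤ) : locEval G (f • ω') v = f * locEval G ω' v := by
  simp only [locEval_apply, AlternatingMap.smul_apply, smul_eq_mul, Finset.mul_sum, mul_assoc]

/-- `locEval 0 = 0`. [cite: GortzWedhorn2023, Remark 17.19 (4)] -/
@[simp]
theorem locEval_zero (v : Fin p → Fin N → ℤ) : locEval G (0 : PolyForm k (N + 1) p) v = 0 := by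
  simp [locEval_apply]

/-- On `0`-forms `locEval` is the coefficient. [cite: GortzWedhorn2023, Remark 17.19 (4)] -/
theorem locEval_ofPoly (f : MvPolynomial (Fin (N + 1)) k) (v : Fin 0 → Fin N → ℤ) :
    locEval G (ofPoly f) v = f := by
  simp [locEval_apply, Finset.univ_unique]

variable (G) in
/-- **The derivation `W_v`** applied to a polynomial: `W_v(f') = Σᵢ (W_v)ᵢ ∂f'/∂Tᵢ`. [folklore] -/
def locD (w : Fin N → ℤ) (f' : MvPolynomial (Fin (N + 1)) k) : MvPolynomial (Fin (N + 1)) k :=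
  ∑ i : Fin (N + 1), weight G i w * pderiv i f'

/-- Leibniz rule for `W_v`. [cite: GortzWedhorn2023, Prop. 17.54] -/
theorem locD_mul (w : Fin N → ℤ) (f g : MvPolynomial (Fin (N + 1)) k) :
    locD G w (f * g) = f * locD G w g + g * locD G w f := by
  simp only [locD, Derivation.leibniz, smul_eq_mul, mul_add, Finset.sum_add_distrib, Finset.mul_sum]
  congr 1 <;> exact Finset.sum_congr rfl fun i _ => by ring

/-- `W_v(Tⱼ) = vⱼ` for `j < N`. [cite: GortzWedhorn2023, Remark 17.19 (4)] -/
theorem locD_X_castSucc (w : Fin N → ℤ) (j : Fin N) :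
    locD G w (X (Fin.castSucc j)) = C (w j : k) := by
  classical
  rw [locD, Finset.sum_eq_single (Fin.castSucc j) (fun i _ hi => by rw [pderiv_X_of_ne hi.symm, mul_zero])
    (fun h => absurd (Finset.mem_univ _) h), pderiv_X_self, mul_one, weight_castSucc]

/-- **`W_v` is tangent to `tG = 1`**: `W_v(tG − 1) = −(tG − 1) · t · (∂_v G)(T)`. [cite: GortzWedhorn2023, Remark 17.19 (4)] -/
theorem locD_eqn (w : Fin N → ℤ) :
    locD G w (eqn G) = -(eqn G * (X (Fin.last N) * rename Fin.castSucc (dirDeriv w G))) := by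
  classical
  have hlast : pderiv (Fin.last N) (rename Fin.castSucc G : P') = 0 := by
    refine pderiv_eq_zero_of_notMem_vars fun h => ?_
    obtain ⟨j, -, hj⟩ := Finset.mem_image.mp (vars_rename Fin.castSucc G h)
    exact (Fin.castSucc_lt_last j).ne hj
  have hcs : ∀ j : Fin N, pderiv (Fin.castSucc j) (eqn G) =
      X (Fin.last N) * rename Fin.castSucc (pderiv j G) := by
    intro j
    rw [eqn, map_sub, Derivation.leibniz, smul_eq_mul, smul_eq_mul,
      pderiv_rename (Fin.castSucc_injective N), pderiv_X_of_ne (Fin.castSucc_lt_last j).ne', mul_zero,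
      add_zero, Derivation.map_one_eq_zero, sub_zero]
  have hl : pderiv (Fin.last N) (eqn G) = rename Fin.castSucc G := by
    rw [eqn, map_sub, Derivation.leibniz, smul_eq_mul, smul_eq_mul, hlast, mul_zero, zero_add,
      pderiv_X_self, mul_one, Derivation.map_one_eq_zero, sub_zero]
  have hdir : rename Fin.castSucc (dirDeriv w G) =
      ∑ j : Fin N, C (w j : k) * rename Fin.castSucc (pderiv j G) := by
    rw [dirDeriv_apply, map_sum]
    exact Finset.sum_congr rfl fun j _ => by rw [smul_eq_C_mul, map_mul, rename_C]
  have hS : ∑ j : Fin N, weight G (Fin.castSucc j) w * pderiv (Fin.castSucc j) (eqn G) =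
      X (Fin.last N) * rename Fin.castSucc (dirDeriv w G) := by
    rw [hdir, Finset.mul_sum]
    exact Finset.sum_congr rfl fun j _ => by rw [weight_castSucc, hcs]; ring
  rw [locD, Fin.sum_univ_castSucc, hS, hl, weight_last, eqn]
  ring

/-- **`locEval` of `df' ∧ β`**: `(df' ∧ β)(W_{v₀}, …, W_{v_p}) = Σᵢ (−1)ⁱ W_{vᵢ}(f') β(…, Ŵ_{vᵢ}, …)`
(pointwise multilinear algebra; reindex `J = (j, J')` at each slot). [cite: GortzWedhorn2023, Prop. 17.54] -/
theorem locEval_dWedge (f' : MvPolynomial (Fin (N + 1)) k) (β : PolyForm k (N + 1) p)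
    (v : Fin (p + 1) → Fin N → ℤ) :
    locEval G (dWedge f' β) v =
      ∑ l : Fin (p + 1), (-1) ^ (l : ℕ) * (locD G (v l) f' * locEval G β (l.removeNth v)) := by
  rw [locEval_apply]
  simp_rw [dWedge_apply, Finset.sum_mul]
  rw [Finset.sum_comm]
  refine Finset.sum_congr rfl fun l _ => ?_
  rw [sum_eq_sum_sum_insertNth l, locD, locEval_apply, Finset.sum_mul_sum, Finset.mul_sum]
  refine Finset.sum_congr rfl fun j _ => ?_
  rw [Finset.mul_sum]
  refine Finset.sum_congr rfl fun J _ => ?_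
  simp only [Fin.insertNth_apply_same, removeNth_single, Fin.removeNth,
    Fin.insertNth_apply_succAbove, Fin.prod_univ_succAbove _ l, dirDeriv_single_eq_pderiv]
  ring

/-- **`locEval` of a pulled-back form is its value**: `(θ(T))(W_{v₁}, …, W_{v_p}) = θ(v₁, …, v_p)(T)`
(the fields `W_v` project to the constant fields `v` on `𝔸ᴺ`). [cite: GortzWedhorn2023, Remark 17.19 (4)] -/
theorem locEval_comap : ∀ {p : ℕ} (θ : PolyForm k N p) (v : Fin p → Fin N → ℤ),
    locEval G (PolyForm.comap (incl N) θ) v = rename Fin.castSucc (θ v)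
  | 0, θ, v => by
    obtain ⟨g, rfl⟩ := (ofPoly (k := k) (n := N)).surjective θ
    rw [PolyForm.comap_ofPoly, bind₁_incl_apply, locEval_ofPoly, ofPoly_apply]
  | p + 1, θ, v => by
    induction θ using dWedge_X_induction generalizing v with
    | zero => rw [map_zero, locEval_zero, AlternatingMap.zero_apply, map_zero]
    | add a b ha hb => rw [map_add, locEval_add, ha, hb, AlternatingMap.add_apply, map_add]
    | gen j α =>
      rw [PolyForm.comap_dWedge, bind₁_X_right, incl_apply, locEval_dWedge, dWedge_apply, map_sum]
      refine Finset.sum_congr rfl fun l _ => ?_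
      rw [locD_X_castSucc, locEval_comap α, dirDeriv_X, map_mul, map_mul, map_pow, map_neg, map_one,
        rename_C]

/-! ### The kernel of the restriction consists of `G`-power torsion -/

variable (G p) in
/-- The forms `δ` on `𝔸ᴺ⁺¹` all of whose evaluations `δ(W_{v₁}, …, W_{v_p})` are divisible by
`tG − 1`; a `P'`-submodule containing the forms vanishing on `tG = 1`. [folklore] -/
def kerCond : Submodule (MvPolynomial (Fin (N + 1)) k) (PolyForm k (N + 1) p) where
  carrier := {δ | ∀ v, locEval G δ v ∈ Ideal.span {eqn G}}
  zero_mem' v := by rw [locEval_zero]; exact Submodule.zero_mem _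
  add_mem' ha hb v := by rw [locEval_add]; exact Submodule.add_mem _ (ha v) (hb v)
  smul_mem' c δ hδ v := by rw [locEval_smul]; exact Ideal.mul_mem_left _ c (hδ v)

/-- `W_v(f)` is divisible by `tG − 1` when `f` is. [cite: GortzWedhorn2023, Remark 17.19 (4)] -/
theorem locD_mem_span_eqn {f : MvPolynomial (Fin (N + 1)) k} (hf : f ∈ Ideal.span {eqn G})
    (w : Fin N → ℤ) : locD G w f ∈ Ideal.span {eqn G} := by
  obtain ⟨a, rfl⟩ := Ideal.mem_span_singleton'.mp hf
  rw [locD_mul, locD_eqn, mul_neg, ← neg_mul, ← mul_assoc]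
  exact Submodule.add_mem _
    (Ideal.mul_mem_right _ _ (Ideal.mul_mem_left _ _ (Ideal.mem_span_singleton_self _)))
    (Ideal.mul_mem_right _ _ (Ideal.mem_span_singleton_self _))

/-- `df ∧ η ∈ kerCond` for `f` divisible by `tG − 1`. [cite: GortzWedhorn2023, Remark 17.19 (4)] -/
theorem dWedge_mem_kerCond {f : MvPolynomial (Fin (N + 1)) k} (hf : f ∈ Ideal.span {eqn G})
    (η : PolyForm k (N + 1) p) : dWedge f η ∈ kerCond G (p + 1) := fun v => by
  rw [locEval_dWedge]
  exact Submodule.sum_mem _ fun l _ =>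
    Ideal.mul_mem_left _ _ (Ideal.mul_mem_right _ _ (locD_mem_span_eqn hf (v l)))

/-- `(tG − 1)·Ω ⊆ kerCond`. [cite: GortzWedhorn2023, Remark 17.19 (4)] -/
theorem smul_top_le_kerCond : Ideal.span {eqn G} • ⊤ ≤ kerCond G p :=
  Submodule.smul_le.mpr fun c hc δ _ v => by
    rw [locEval_smul]
    exact Ideal.mul_mem_right _ _ hc

/-- **Forms vanishing on `tG = 1` evaluate to multiples of `tG − 1` on the tangent fields.**
[cite: GortzWedhorn2023, Remark 17.19 (4)] -/
theorem vanishingForms_span_le_kerCond : ∀ {p : ℕ}, D p ≤ kerCond G p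
  | 0 => smul_top_le_kerCond
  | p + 1 => by
    rw [vanishingForms_succ]
    exact sup_le smul_top_le_kerCond (Submodule.span_le.mpr <| by
      rintro _ ⟨f, hf, η, rfl⟩
      exact dWedge_mem_kerCond hf η)

variable (G) in
/-- Degree `0`: a polynomial `θ₀ ∈ k[T]` whose image in `k[T, t]` is divisible by `tG − 1` is
killed by a power of `G` (read the divisibility in `k[T]_G = k[T, t]/(tG − 1)`). [cite: Hartshorne1977, II Prop. 2.2 (b)] -/
theorem exists_pow_mul_eq_zero_of_rename_mem {θ₀ : P}
    (h : rename Fin.castSucc θ₀ ∈ Ideal.span {eqn G}) : ∃ j : ℕ, G ^ j * θ₀ = 0 := by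
  obtain ⟨a, ha⟩ := Ideal.mem_span_singleton'.mp h
  let L := Localization.Away G
  let σ : Fin (N + 1) → L := Fin.snoc (fun j => algebraMap P L (X j)) (IsLocalization.Away.invSelf G)
  let φ : P' →+* L := eval₂Hom ((algebraMap P L).comp C) σ
  have hφ : ∀ f : P, φ (rename Fin.castSucc f) = algebraMap P L f := by
    intro f
    have hcomp : φ.comp (rename Fin.castSucc : P →ₐ[k] P').toRingHom = algebraMap P L :=
      ringHom_ext (fun r => by simp [φ]) (fun j => by simp [φ, σ])
    exact RingHom.congr_fun hcomp f
  have hu : φ (eqn G) = 0 := by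
    rw [eqn, map_sub, map_mul, hφ, map_one]
    simp [φ, σ, mul_comm (IsLocalization.Away.invSelf G)]
  have h0 : algebraMap P L θ₀ = 0 := by rw [← hφ, ← ha, map_mul, hu, mul_zero]
  obtain ⟨⟨_, j, rfl⟩, hj⟩ := (IsLocalization.map_eq_zero_iff (Submonoid.powers G) L θ₀).mp h0
  exact ⟨j, hj⟩

open Set.powersetCard in
/-- A form `θ` on `𝔸ᴺ` whose pull-back `θ(T)` vanishes on the hypersurface `tG = 1` is killed by
a power of `G`: `Ω^p_{k[T]} → Ω^p_{k[T]_G}` has `G`-power-torsion kernel. [cite: GortzWedhorn2023, Remark 17.19 (4)] -/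
theorem exists_pow_smul_eq_zero_of_comap_mem {θ : PolyForm k N p}
    (h : PolyForm.comap (incl N) θ ∈ D p) : ∃ j : ℕ, G ^ j • θ = 0 := by
  have hv : ∀ v : Fin p → Fin N → ℤ, ∃ j : ℕ, G ^ j * θ v = 0 := fun v =>
    exists_pow_mul_eq_zero_of_rename_mem G
      (by rw [← locEval_comap]; exact vanishingForms_span_le_kerCond h v)
  choose j hj using hv
  refine ⟨Finset.univ.sup fun s : Set.powersetCard (Fin N) p =>
    j fun a => Pi.single (ofFinEmbEquiv.symm s a) 1, ?_⟩
  refine AlternatingMap.ext_of_basis_powersetCard (Pi.basisFun ℤ (Fin N)) fun s => ?_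
  simp only [Pi.basisFun_apply, AlternatingMap.smul_apply, AlternatingMap.zero_apply, smul_eq_mul]
  obtain ⟨d, hd⟩ := Nat.exists_eq_add_of_le (Finset.le_sup
    (f := fun s : Set.powersetCard (Fin N) p => j fun a => Pi.single (ofFinEmbEquiv.symm s a) 1)
    (Finset.mem_univ s))
  rw [hd, add_comm, pow_add, mul_assoc, hj, mul_zero]

/-- **The kernel of `Ω^p(X) → Ω^p(X_G)` is the `G`-power torsion**: if `ω₀(T)` vanishes on `X_G`
then some `G^j ω₀` vanishes on `X`. [cite: GortzWedhorn2023, Remark 17.19 (4)] -/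
theorem exists_pow_smul_mem_of_comap_mem {ω₀ : PolyForm k N p}
    (h : PolyForm.comap (incl N) ω₀ ∈ vanishingForms (ideal I G) p) :
    ∃ j : ℕ, G ^ j • ω₀ ∈ vanishingForms I p := by
  obtain ⟨m, ω, hω, hδ⟩ := vanishingForms_ideal_le_liftable h
  rw [← map_pow, ← bind₁_incl_apply, ← PolyForm.comap_polySmul, ← map_sub] at hδ
  obtain ⟨j, hj⟩ := exists_pow_smul_eq_zero_of_comap_mem hδ
  refine ⟨j + m, ?_⟩
  rw [smul_sub, sub_eq_zero, smul_smul, ← pow_add] at hj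
  rw [hj]
  exact Submodule.smul_mem _ _ hω

/-! ### The restriction `Ω^p(X) → Ω^p(X_G)` is a localization at `G` -/

/-- **Kernel**: regular forms with the same restriction to `X_G` agree after multiplication by a
power of `G`. [cite: Hartshorne1977, II Prop. 8.2A] -/
theorem exists_pow_smul_eq_of_restrict_eq {r₁ r₂ : RegularForm I p}
    (h : restrict I G p r₁ = restrict I G p r₂) : ∃ j : ℕ, G ^ j • r₁ = G ^ j • r₂ := by
  obtain ⟨ω₁, rfl⟩ := RegularForm.mk_surjective I r₁
  obtain ⟨ω₂, rfl⟩ := RegularForm.mk_surjective I r₂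
  rw [restrict_mk, restrict_mk, RegularForm.mk_eq_mk_iff, ← map_sub] at h
  obtain ⟨j, hj⟩ := exists_pow_smul_mem_of_comap_mem h
  refine ⟨j, ?_⟩
  rw [← map_smul, ← map_smul, RegularForm.mk_eq_mk_iff, ← smul_sub]
  exact hj

/-- **Surjectivity up to powers of `G`**: every regular form on `X_G` is `G^{-m}` times the
restriction of a regular form on `X`. [cite: Hartshorne1977, II Prop. 8.2A] -/
theorem exists_pow_smul_eq_restrict (r : RegularForm (ideal I G) p) :
    ∃ (m : ℕ) (r₀ : RegularForm I p), rename Fin.castSucc G ^ m • r = restrict I G p r₀ := by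
  obtain ⟨ω', rfl⟩ := RegularForm.mk_surjective _ r
  obtain ⟨m, ω, h⟩ := exists_pow_smul_sub_comap_mem G ω'
  refine ⟨m, RegularForm.mk I ω, ?_⟩
  rw [← map_smul, restrict_mk, RegularForm.mk_eq_mk_iff]
  exact vanishingForms_mono (span_eqn_le_ideal I G) p h

variable (I G p) in
/-- **`Ω^p(X_G)` as a `k[T]`-module** (through `Tⱼ ↦ Tⱼ`, i.e. through `Γ(X, 𝒪) → Γ(X_G, 𝒪)`):
a type synonym of `RegularForm (ideal I G) p` carrying `Module.compHom` along
`rename Fin.castSucc : k[T] → k[T, t]`. [folklore] -/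
def Forms : Type _ := RegularForm (ideal I G) p

namespace Forms

/-- Additive structure of `Ω^p(X_G)`. [folklore] -/
instance instAddCommGroup : AddCommGroup (Forms I G p) :=
  inferInstanceAs (AddCommGroup (RegularForm (ideal I G) p))

/-- The `k[T, t]`-module structure of `Ω^p(X_G)`. [folklore] -/
instance instModulePoly' : Module (MvPolynomial (Fin (N + 1)) k) (Forms I G p) :=
  inferInstanceAs (Module (MvPolynomial (Fin (N + 1)) k) (RegularForm (ideal I G) p))

/-- The `k[T]`-module structure of `Ω^p(X_G)` through `Tⱼ ↦ Tⱼ`. [folklore] -/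
instance instModulePoly : Module (MvPolynomial (Fin N) k) (Forms I G p) :=
  Module.compHom (RegularForm (ideal I G) p) (rename Fin.castSucc : P →ₐ[k] P').toRingHom

variable (I G p) in
/-- The identification `Ω^p(X_G) = Forms I G p` (identity map). [folklore] -/
def of : RegularForm (ideal I G) p ≃ₗ[MvPolynomial (Fin (N + 1)) k] Forms I G p :=
  LinearEquiv.refl _ _

/-- The `k[T]`-action on `Forms` is the `k[T, t]`-action through `Tⱼ ↦ Tⱼ`. [cite: GortzWedhorn2023, Remark 17.19 (4)] -/
theorem smul_def (f : P) (x : Forms I G p) : f • x = (rename Fin.castSucc f : P') • x :=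
  rfl

end Forms

variable (I G p) in
/-- **The restriction `Ω^p(X) → Ω^p(X_G)` as a `k[T]`-linear map.** [cite: GortzWedhorn2023, Remark 17.19 (2)] -/
def toForms : RegularForm I p →ₗ[MvPolynomial (Fin N) k] Forms I G p where
  toFun r := Forms.of I G p (restrict I G p r)
  map_add' a b := by rw [map_add, map_add]
  map_smul' f r := by
    obtain ⟨ω, rfl⟩ := RegularForm.mk_surjective I r
    rw [RingHom.id_apply, Forms.smul_def, ← map_smul, ← map_smul, restrict_mk, restrict_mk,
      PolyForm.comap_polySmul, bind₁_incl_apply, map_smul]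

/-- `toForms` is the restriction. [cite: GortzWedhorn2023, Remark 17.19 (2)] -/
theorem toForms_apply (r : RegularForm I p) : toForms I G p r = Forms.of I G p (restrict I G p r) :=
  rfl

/-- **`Ω^p(X_G) = Ω^p(X)_G`: the restriction of regular forms from `X = V(I) ⊆ 𝔸ᴺ` to the basic
open `X_G = V(I, tG − 1) ⊆ 𝔸ᴺ⁺¹` is a localization at the powers of `G`** (as `k[T]`-modules):
`G` acts invertibly on `Ω^p(X_G)` (`bijective_rename_smul`), every form on `X_G` is `G^{-m}` times
a restricted form (`exists_pow_smul_eq_restrict`), and the kernel is the `G`-power torsion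
(`exists_pow_smul_eq_of_restrict_eq`). Kähler differentials and their exterior powers commute with
localization: Görtz–Wedhorn II, Remark 17.19 (4), eq. (17.4.1) `T⁻¹Ω¹_{A/R} = Ω¹_{T⁻¹A/R}` with
(17.10) (`Ω^p = ⋀^p Ω¹` quasi-coherent); Hartshorne II Prop. 8.2A
(`Ω_{S⁻¹B/A} ≅ S⁻¹Ω_{B/A}`). [cite: GortzWedhorn2023, Remark 17.19 (4)]
[cite: Hartshorne1977, II Prop. 8.2A] -/
instance isLocalizedModule_toForms : IsLocalizedModule (Submonoid.powers G) (toForms I G p) where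
  map_units s := by
    obtain ⟨_, j, rfl⟩ := s
    rw [map_pow]
    refine IsUnit.pow j ((Module.End.isUnit_iff _).mpr ?_)
    exact bijective_rename_smul
  surj y := by
    obtain ⟨m, r₀, h⟩ := exists_pow_smul_eq_restrict ((Forms.of I G p).symm y)
    refine ⟨(r₀, ⟨G ^ m, m, rfl⟩), ?_⟩
    rw [Submonoid.smul_def, Forms.smul_def, map_pow]
    exact h
  exists_of_eq h := by
    obtain ⟨j, hj⟩ := exists_pow_smul_eq_of_restrict_eq ((Forms.of I G p).injective h)
    exact ⟨⟨G ^ j, j, rfl⟩, hj⟩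

end BasicOpen

/-! ### Complements: `Ω^p(V(I))` as a `k[T]/I`-module; change of presentation -/

namespace RegularForm

variable {k : Type*} [CommRing k] {n m p : ℕ} (I : Ideal (MvPolynomial (Fin n) k))

/-- `I` acts trivially on `Ω^p(V(I))` (`I·Ω^p` vanishes on `V(I)`). [cite: Hartshorne1977, II Prop. 8.4A] -/
theorem isTorsionBySet : Module.IsTorsionBySet (MvPolynomial (Fin n) k) (RegularForm I p) I := by
  rintro x ⟨f, hf⟩
  obtain ⟨ω, rfl⟩ := RegularForm.mk_surjective I x
  rw [← map_smul, RegularForm.mk_eq_zero_iff]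
  exact smul_mem_vanishingForms I hf ω

/-- **`Ω^p(V(I))` is a module over the coordinate ring `k[T]/I = Γ(V(I), 𝒪)`.** [folklore] -/
instance instModuleQuotient : Module (MvPolynomial (Fin n) k ⧸ I) (RegularForm I p) :=
  (isTorsionBySet I (p := p)).module

/-- The `k[T]`- and `k[T]/I`-actions on `Ω^p(V(I))` are compatible. [folklore] -/
instance instIsScalarTowerQuotient :
    IsScalarTower (MvPolynomial (Fin n) k) (MvPolynomial (Fin n) k ⧸ I) (RegularForm I p) :=
  (isTorsionBySet I (p := p)).isScalarTower

/-- The class of `f` acts as `f`. [cite: Hartshorne1977, II Prop. 8.4A] -/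
theorem mk_smul (f : MvPolynomial (Fin n) k) (x : RegularForm I p) :
    Ideal.Quotient.mk I f • x = f • x :=
  rfl

variable {I} {I' : Ideal (MvPolynomial (Fin m) k)}

/-- **Change of presentation.** Polynomial maps `F : 𝔸ⁿ → 𝔸ᵐ` (`V(I) → V(I')`) and
`F' : 𝔸ᵐ → 𝔸ⁿ` (`V(I') → V(I)`) that are mutually inverse modulo the ideals — i.e. induce inverse
algebra isomorphisms `k[y]/I' ≅ k[x]/I` — induce inverse isomorphisms `Ω^p(V(I')) ≅ Ω^p(V(I))`
(functoriality `RegularForm.comap_comp` and independence of the lift `RegularForm.comap_congr`):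
the module of regular `p`-forms depends only on the affine scheme, not on its embedding.
[cite: GortzWedhorn2023, Prop. 17.56] -/
def comapEquiv (F : Fin m → MvPolynomial (Fin n) k) (F' : Fin n → MvPolynomial (Fin m) k)
    (hF : I'.map (bind₁ F : MvPolynomial (Fin m) k →ₐ[k] MvPolynomial (Fin n) k) ≤ I)
    (hF' : I.map (bind₁ F' : MvPolynomial (Fin n) k →ₐ[k] MvPolynomial (Fin m) k) ≤ I')
    (h₁ : ∀ j, X j - bind₁ F (F' j) ∈ I) (h₂ : ∀ j, X j - bind₁ F' (F j) ∈ I') (p : ℕ) :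
    RegularForm I' p ≃ₗ[k] RegularForm I p :=
  LinearEquiv.ofLinear (RegularForm.comap F hF p) (RegularForm.comap F' hF' p)
    (by
      rw [RegularForm.comap_comp F' F hF' hF (H := X)
        (by rw [bind₁_X_left]; exact (Ideal.map_id I).le) h₁ p]
      exact RegularForm.comap_X_eq_id _ p)
    (by
      rw [RegularForm.comap_comp F F' hF hF' (H := X)
        (by rw [bind₁_X_left]; exact (Ideal.map_id I').le) h₂ p]
      exact RegularForm.comap_X_eq_id _ p)

/-- `comapEquiv` is `comap F`. [cite: GortzWedhorn2023, Prop. 17.56] -/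
@[simp]
theorem comapEquiv_apply (F : Fin m → MvPolynomial (Fin n) k) (F' : Fin n → MvPolynomial (Fin m) k)
    (hF : I'.map (bind₁ F : MvPolynomial (Fin m) k →ₐ[k] MvPolynomial (Fin n) k) ≤ I)
    (hF' : I.map (bind₁ F' : MvPolynomial (Fin n) k →ₐ[k] MvPolynomial (Fin m) k) ≤ I')
    (h₁ : ∀ j, X j - bind₁ F (F' j) ∈ I) (h₂ : ∀ j, X j - bind₁ F' (F j) ∈ I') (p : ℕ)
    (x : RegularForm I' p) :
    comapEquiv F F' hF hF' h₁ h₂ p x = RegularForm.comap F hF p x :=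
  rfl

/-- The inverse of `comapEquiv` is `comap F'`. [cite: GortzWedhorn2023, Prop. 17.56] -/
@[simp]
theorem comapEquiv_symm_apply (F : Fin m → MvPolynomial (Fin n) k)
    (F' : Fin n → MvPolynomial (Fin m) k)
    (hF : I'.map (bind₁ F : MvPolynomial (Fin m) k →ₐ[k] MvPolynomial (Fin n) k) ≤ I)
    (hF' : I.map (bind₁ F' : MvPolynomial (Fin n) k →ₐ[k] MvPolynomial (Fin m) k) ≤ I')
    (h₁ : ∀ j, X j - bind₁ F (F' j) ∈ I) (h₂ : ∀ j, X j - bind₁ F' (F j) ∈ I') (p : ℕ)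
    (x : RegularForm I p) :
    (comapEquiv F F' hF hF' h₁ h₂ p).symm x = RegularForm.comap F' hF' p x :=
  rfl

end RegularForm

end AffineDeRham

end Literature.AlgebraicGeometry.Motives

end
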